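import Literature.Computability.AlgebraicComplexity.BorderRankMatMulThreeSeventeen
import Literature.Computability.AlgebraicComplexity.BorderRankMatMulThreeSmirnov
import Literature.Computability.AlgebraicComplexity.BorderRankMatMulThreeWindow
import Literature.Computability.AlgebraicComplexity.KoszulFlatteningBorderRank
import Literature.Computability.AlgebraicComplexity.BrentEquations
import Literature.Computability.AlgebraicComplexity.SmallFormatRankProofs
import Literature.Computability.AlgebraicComplexity.SmallFormatRankLaderman
import Literature.Barriers.MatrixMultiplication.LinearRankMethodBarrierProofs
import Literature.Computability.AlgebraicComplexity.MatMulRankGF2Wang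
import Summits.Ventures.MM22.Rank333.SchemeCertificate
import Mathlib.Data.ZMod.Basic
import HarnessLib

/-!
# MM22 venture — the lower-bound side for `⟨3,3,3⟩`: targets, the printed bounds, flattening certificates

HONEST FRAMING (cell `pub-mm22`, seat p3). The venture's second possible outcome is "an improved
lower bound certificate" for `3 × 3` matrix multiplication. This file TYPES that outcome over the
tree's definitions — rank `tensorRank` (Bläser 2013 §4) and algebraic border rank `algBorderRank`
over `K[ε]` (Bläser 2013 Def. 6.1; over `ℂ` the border rank of the sources, Alder's theorem, see
`BorderRankMatMulSmall.lean`) — and collects, AT `n = 3` and without restating them, the bounds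
PRINTED in the literature that the tree already holds (all PROVED there):

| statement at `n = 3` | source, as printed | tree | status |
|---|---|---|---|
| `19 ≤ R_K(⟨3,3,3⟩)`, every field `K` | Bläser 2003, Cor. 9: "For any field `k`, `R(⟨3,3,3⟩) ≥ 19`" | `blaser2003_cor9_holds` | proved |
| `R_K(⟨3,3,3⟩) ≤ 23`, every commutative ring | Laderman 1976 (23 products) | `tensorRank_matMulTensor_three_le_twentyThree` | proved |
| `15 ≤ R̲(⟨3,3,3⟩)`, char. `0` | Landsberg–Ottaviani 2015, Thm. 2.1 with §3: `R̲(M⟨n⟩) ≥ 2n² − n` (Koszul–Young flattening) | `LandsbergOttaviani2015_algBorderRank_matMulTensor` | proved |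
| `16 ≤ R̲(⟨3,3,3⟩)`, every field | Landsberg–Michałek 2018, Thm. 1.1 at `(n,m,w) = (3,1,3)` (= Landsberg 2017 Thm. 5.4.5.1; border substitution + Koszul) | `LandsbergMichalek_sixteen_le_algBorderRank_matMulTensor_three` (and the named fact `LandsbergMichalek2018_thm_1_1`, read here at `n = 3`) | proved |
| `17 ≤ R̲(⟨3,3,3⟩)`, char. `0` | Conner–Harper–Landsberg 2023, Thm. 1.1: "`R̲(M⟨3⟩) ≥ 17`" | `seventeen_le_algBorderRank_matMulTensor_three` | proved |
| `R̲(⟨3,3,3⟩) ≤ 20`, every commutative ring | Smirnov 2013 (approximate algorithm, 20 products) | `Smirnov2013_algBorderRank_matMulTensor_three_le` | proved |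
| `rank(T_A'^{∧p}) ≤ C(2p,p)·R̲(T)` (the flattening inequality) | Landsberg–Ottaviani 2013 Prop. 4.1.1 / 2015 Thm. 2.1, as CGLV 2022 §3 eq. (8) | `rank_koszulFlattening_le_choose_mul_algBorderRank` | proved |

so the open windows are `R ∈ [19, 23]` (every field), `R̲ ∈ [17, 20]` (char. `0`) and
`R̲ ∈ [16, 20]` (every field, e.g. `𝔽₂`; `window_algBorderRank_three_allFields`), and the
venture's lower-bound TARGETS are the next integers: `RankGe20` (beat Bläser), `RankGe20F2` (the
same over `𝔽₂` only — a FINITE statement: the Brent system `B(3,19)` has no solution over `𝔽₂`,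
`rankGe20F2_iff_brent_unsat`, the shape a SAT refutation addresses) and `BorderRankGe18` (beat CHL).
Nothing here claims any of them. What is PROVED here besides readings: the certificate form of the
Koszul–Young flattening bound specialised to `⟨3,3,3⟩` (`le_algBorderRank_three_of_koszul`: an
exact rank computation `rank K_M(⟨3,3,3⟩) > C(2p,p)(R−1)` certifies `R ≤ R̲`), and its CEILING
(`koszul_certificate_le_eighteen`, `koszul_certificate_le_seventeen`): by the column count
`9·C(2p+1,p)` alone, no one-factor Koszul flattening of `⟨3,3,3⟩` can certify more than `18`, nor
more than `17` with `p ≤ 8` — so `BorderRankGe18` is out of reach of this method for every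
practical `p`, consistent with the catalogued determinantal barrier
(`Literature.Barriers.MatrixMultiplication.LinearRankMethodBarrier`, ceiling `6m − 4 = 50` for
`m = 9`, which does not bite at `18`) and with the history (LO's flattenings gave `15`; `16` and `17`
needed the border substitution method and border apolarity).

STATUS UPDATE (appended 2026-08-22): `RankGe20F2` is PROVED IN PRINT — C. Wang, arXiv:2603.07280
(2026), Thm. 1: "`R_{𝔽₂}(⟨3,3,3⟩) ≥ 20`", by a verifier-checked certificate (496 orbits of constraint
subspaces; 32 MiB; re-verified independently by Beuchert) — and is in the tree as the NAMED FACT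
`Wang2026_thm1` (`MatMulRankGF2Wang.lean`; a kernel replay through the tree's checker
`OmegaCensus/SmallFormats/GF2OrbitSweep.lean` is rated out of reach at `6.6·10⁷` DFS leaves). Hence
`rankGe20F2_of_wang`, the `𝔽₂` windows `[20, 23]` / with a rank-22 scheme `[20, 22]`, and the NEW
`𝔽₂` target `RankGe21F2` (`↔` the Brent system `B(3,20)` is unsatisfiable over `𝔽₂`,
`rankGe21F2_iff_brent_unsat`). Over every field other than `𝔽₂` the printed bound is still Bläser's
`19`, so `RankGe20` (all fields) remains open as stated.

## References

* C. Wang, *Automated Lower Bounds for Bilinear Complexity over Finite Fields*, arXiv:2603.07280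
  (2026), Thm. 1, §7–§8. [Wang2026]
* M. Bläser, J. Complexity 19 (2003) 43–60, Thm. 14, Cor. 9. [Blaser2003]
* J. D. Laderman, Bull. AMS 82 (1976) 126–128. [Laderman1976]
* J. M. Landsberg, G. Ottaviani, Theory of Computing 11 (2015) 285–298, Thm. 2.1 and §3;
  Ann. Mat. Pura Appl. 192 (2013), Prop. 4.1.1. [LandsbergOttaviani2015]
* J. M. Landsberg, M. Michałek, IMRN 2018 (15) 4722–4733, Thm. 1.1. [LandsbergMichalek2018]
* A. Conner, A. Harper, J. M. Landsberg, Forum Math. Pi 11 (2023) e17, Thm. 1.1. [ConnerHarperLandsberg2023]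
* A. V. Smirnov, Comput. Math. Math. Phys. 53 (2013) 1781–1795. [Smirnov2013]
* A. Conner, F. Gesmundo, J. M. Landsberg, E. Ventura, comput. complexity 31 (2022), §3 eq. (8).
  [ConnerGesmundoLandsbergVentura2022]
* M. J. H. Heule, M. Kauers, M. Seidl, J. Symbolic Comput. 104 (2021) 899–916, §2. [HeuleKauersSeidl2021]
-/

noncomputable section

namespace Summit.Ventures.MM22

open Literature.Computability.AlgebraicComplexity
open MvPolynomial

/-! ## The venture's lower-bound targets, typed -/

/-- **Target (rank, every field)**: `20 ≤ R_K(⟨3,3,3⟩)` for every field `K` — one more than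
Bläser 2003, Cor. 9. OPEN; a statement, not a theorem. -/
def RankGe20 : Prop :=
  ∀ (K : Type) [Field K], 20 ≤ tensorRank (matMulTensor K 3 3 3)

/-- **Target (rank, over `𝔽₂` only)**: `20 ≤ R_{𝔽₂}(⟨3,3,3⟩)`, i.e. NO bilinear scheme with `19`
products over `𝔽₂` — a finite statement (the Brent system `B(3,19)` is unsatisfiable over `𝔽₂`,
`rankGe20F2_iff_brent_unsat`), the shape a SAT refutation with symmetry reduction addresses.
OPEN; a statement, not a theorem. -/
def RankGe20F2 : Prop :=
  20 ≤ tensorRank (matMulTensor (ZMod 2) 3 3 3)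

/-- **Target (border rank)**: `18 ≤ R̲(⟨3,3,3⟩)` over `ℂ` (algebraic border rank over `ℂ[ε]`) —
one more than Conner–Harper–Landsberg 2023, Thm. 1.1. OPEN; a statement, not a theorem. -/
def BorderRankGe18 : Prop :=
  18 ≤ algBorderRank (matMulTensor ℂ 3 3 3)

/-- The all-fields rank target implies the `𝔽₂` one. -/
theorem RankGe20.rankGe20F2 (h : RankGe20) : RankGe20F2 :=
  h (ZMod 2)

/-- The rank target excludes the scheme target over every field: `RankGe20 → ¬ Rank22Scheme K` is
FALSE in general — they concern different ends of the window; what IS excluded is a rank-19 scheme.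
Precisely: `RankGe20F2 ↔ ¬ R_{𝔽₂}(⟨3,3,3⟩) ≤ 19`. -/
theorem rankGe20F2_iff_not_le : RankGe20F2 ↔ ¬ tensorRank (matMulTensor (ZMod 2) 3 3 3) ≤ 19 := by
  unfold RankGe20F2
  omega

/-- **`RankGe20F2` is the unsatisfiability of the Brent system `B(3,19)` over `𝔽₂`** (the tree's
`brentSystem`, Heule–Kauers–Seidl 2021 §2: `729` cubic equations in `3·19·9 = 513` unknowns):
no assignment `x : Fin 3 × Fin 19 × (Fin 3 × Fin 3) → 𝔽₂` annihilates all of them.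
[cite: HeuleKauersSeidl2021, §2 (the Brent equations)] -/
theorem rankGe20F2_iff_brent_unsat :
    RankGe20F2 ↔ ¬ ∃ x : Fin 3 × Fin 19 × (Fin 3 × Fin 3) → ZMod 2,
      ∀ i j k, eval x (brentSystem (ZMod 2) 3 19 i j k) = 0 := by
  rw [rankGe20F2_iff_not_le, tensorRank_le_iff_exists_brent_zero]

/-! ## The printed bounds at `n = 3`

Used by their tree names (not restated): `blaser2003_cor9_holds K : 19 ≤ R_K(⟨3,3,3⟩)`,
`tensorRank_matMulTensor_three_le_twentyThree K : R_K(⟨3,3,3⟩) ≤ 23`,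
`fifteen_le_algBorderRank_matMulTensor_three K`, `seventeen_le_algBorderRank_matMulTensor_three K`
(char. `0`), `Smirnov2013_algBorderRank_matMulTensor_three_le K : R̲ ≤ 20`. -/

/-- **Landsberg–Michałek 2018, Thm. 1.1, read at `(n, m, w) = (3, 1, 3)`**:
`R̲(M_⟨3,3,3⟩) ≥ 2·3·3 − 3 + 1 − ⌊3·C(3,0)/C(4,2)⌋ = 16` over `ℂ` ("the previous lower bounds were
`16` [LM] in 2018", CHL 2023 §1). Conditional on the named fact (not proved in the tree).
[cite: LandsbergMichalek2018, Thm. 1.1] -/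
theorem sixteen_le_algBorderRank_three_of_LM (h : LandsbergMichalek2018_thm_1_1) :
    16 ≤ algBorderRank (matMulTensor ℂ 3 3 3) := by
  have h3 := h 3 1 3 (by norm_num) (by norm_num) (by norm_num)
  norm_num [Nat.choose] at h3
  omega

/-- **The open border-rank window in characteristic `0`**: `17 ≤ R̲(⟨3,3,3⟩) ≤ 20`; the target
`BorderRankGe18` is its next integer. [cite: ConnerHarperLandsberg2023, Thm. 1.1] -/
theorem window_algBorderRank_three (K : Type) [Field K] [CharZero K] :
    17 ≤ algBorderRank (matMulTensor K 3 3 3) ∧ algBorderRank (matMulTensor K 3 3 3) ≤ 20 :=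
  ⟨seventeen_le_algBorderRank_matMulTensor_three K, Smirnov2013_algBorderRank_matMulTensor_three_le K⟩

/-- `BorderRankGe18` says exactly `R̲_ℂ(⟨3,3,3⟩) ∈ {18, 19, 20}`. [cite: ConnerHarperLandsberg2023, Thm. 1.1] -/
theorem borderRankGe18_iff :
    BorderRankGe18 ↔ algBorderRank (matMulTensor ℂ 3 3 3) ∈ Finset.Icc 18 20 := by
  have hw := window_algBorderRank_three ℂ
  simp only [BorderRankGe18, Finset.mem_Icc]
  omega

/-- `RankGe20` says exactly `R_K(⟨3,3,3⟩) ∈ {20, …, 23}` for every field. [cite: Blaser2003, Corollary 9] -/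
theorem rankGe20_iff :
    RankGe20 ↔ ∀ (K : Type) [Field K], tensorRank (matMulTensor K 3 3 3) ∈ Finset.Icc 20 23 := by
  unfold RankGe20
  refine ⟨fun h K _ => ?_, fun h K _ => ?_⟩
  · have := tensorRank_matMulTensor_three_le_twentyThree K
    have hK := h K
    simp only [Finset.mem_Icc]
    exact ⟨hK, this⟩
  · have hK := h K
    simp only [Finset.mem_Icc] at hK
    exact hK.1

/-! ## Flattening certificates for `⟨3,3,3⟩`: the usable form and its ceiling -/

/-- **Koszul–Young flattening certificate for `⟨3,3,3⟩`** (Landsberg–Ottaviani, in the form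
CGLV 2022 §3 eq. (8), proved in the tree): for any `p`, any `M : K^{3×3} → K^{2p+1}` (a matrix)
and any `R`, an exact rank computation `rank K_M(⟨3,3,3⟩) > C(2p,p)·(R−1)` certifies
`R ≤ R̲_K(⟨3,3,3⟩)`. The flattening acts on the tree's FIRST slot of `matMulTensor` (the output slot
`(κ,ν)`); by the cyclic symmetry of `⟨3,3,3⟩` this is no restriction.
[cite: ConnerGesmundoLandsbergVentura2022, §3 eq. (8)] -/
theorem le_algBorderRank_three_of_koszul (K : Type) [Field K] (p : ℕ)
    (M : Matrix (Fin (2 * p + 1)) (Fin 3 × Fin 3) K) {R : ℕ}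
    (hR : (2 * p).choose p * (R - 1) <
      (koszulFlattening p M.mulVecLin (matMulTensor K 3 3 3)).rank) :
    R ≤ algBorderRank (matMulTensor K 3 3 3) :=
  le_algBorderRank_of_lt_rank_koszulFlattening p M (matMulTensor K 3 3 3) hR

/-- Column count: the Koszul flattening matrix of `⟨3,3,3⟩` at level `p` has `9·C(2p+1,p)` columns,
so its rank is at most that. [cite: LandsbergOttaviani2015, §2 (T_A^{∧p})] -/
theorem rank_koszulFlattening_three_le (K : Type) [Field K] (p : ℕ)
    (M : Matrix (Fin (2 * p + 1)) (Fin 3 × Fin 3) K) :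
    (koszulFlattening p M.mulVecLin (matMulTensor K 3 3 3)).rank ≤ (2 * p + 1).choose p * 9 := by
  have h := Matrix.rank_le_card_width (koszulFlattening p M.mulVecLin (matMulTensor K 3 3 3))
  have hc : Fintype.card (PSub (2 * p + 1) p × (Fin 3 × Fin 3)) = (2 * p + 1).choose p * 9 := by
    rw [Fintype.card_prod, card_PSub]
    simp
  rw [hc] at h
  exact h

/-- The binomial identity behind the ceiling: `(p+1)·C(2p+1,p) = (2p+1)·C(2p,p)`. [folklore] -/
theorem succ_mul_choose_two_mul_succ (p : ℕ) :
    (p + 1) * (2 * p + 1).choose p = (2 * p + 1) * (2 * p).choose p := by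
  have h := Nat.add_one_mul_choose_eq (2 * p) p
  rw [Nat.choose_symm_half] at h
  rw [h, mul_comm]

/-- **Ceiling of the method, I**: whatever `p` and `M`, a Koszul-flattening certificate for
`⟨3,3,3⟩` certifies at most `R ≤ 18` — because `rank ≤ 9·C(2p+1,p)` and
`9·C(2p+1,p)/C(2p,p) = 9(2p+1)/(p+1) < 18`. [cite: LandsbergOttaviani2015, §2 (T_A^{∧p})] -/
theorem koszul_certificate_le_eighteen (K : Type) [Field K] (p : ℕ)
    (M : Matrix (Fin (2 * p + 1)) (Fin 3 × Fin 3) K) {R : ℕ}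
    (hR : (2 * p).choose p * (R - 1) <
      (koszulFlattening p M.mulVecLin (matMulTensor K 3 3 3)).rank) : R ≤ 18 := by
  have h1 := hR.trans_le (rank_koszulFlattening_three_le K p M)
  -- multiply through by `p + 1` and use the identity
  have h2 : (p + 1) * ((2 * p).choose p * (R - 1)) < (p + 1) * ((2 * p + 1).choose p * 9) :=
    Nat.mul_lt_mul_of_pos_left h1 (Nat.succ_pos p)
  have h3 : (p + 1) * ((2 * p + 1).choose p * 9) = (2 * p).choose p * (9 * (2 * p + 1)) := by
    rw [← mul_assoc, succ_mul_choose_two_mul_succ]; ring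
  rw [h3, show (p + 1) * ((2 * p).choose p * (R - 1)) = (2 * p).choose p * ((p + 1) * (R - 1)) by ring]
    at h2
  have hpos : 0 < (2 * p).choose p := Nat.choose_pos (by omega)
  have h4 : (p + 1) * (R - 1) < 9 * (2 * p + 1) := Nat.lt_of_mul_lt_mul_left h2
  -- `(p+1)(R-1) < 18(p+1) - 9` forces `R - 1 ≤ 17`
  by_contra hR'
  have h18 : 18 ≤ R - 1 := by omega
  have : (p + 1) * 18 ≤ (p + 1) * (R - 1) := Nat.mul_le_mul_left _ h18
  omega

/-- **Ceiling of the method, II**: with `p ≤ 8` (in particular the maximal honest level `p = 4`,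
`2p + 1 = 9 = dim K^{3×3}`) a Koszul-flattening certificate for `⟨3,3,3⟩` certifies at most
`R ≤ 17` (`9(2p+1)/(p+1) ≤ 17` iff `p ≤ 8`). So `BorderRankGe18` is beyond one-factor Koszul
flattenings at every level `p ≤ 8`. [cite: LandsbergOttaviani2015, §2 (T_A^{∧p})] -/
theorem koszul_certificate_le_seventeen (K : Type) [Field K] {p : ℕ} (hp : p ≤ 8)
    (M : Matrix (Fin (2 * p + 1)) (Fin 3 × Fin 3) K) {R : ℕ}
    (hR : (2 * p).choose p * (R - 1) <
      (koszulFlattening p M.mulVecLin (matMulTensor K 3 3 3)).rank) : R ≤ 17 := by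
  have h1 := hR.trans_le (rank_koszulFlattening_three_le K p M)
  have h2 : (p + 1) * ((2 * p).choose p * (R - 1)) < (p + 1) * ((2 * p + 1).choose p * 9) :=
    Nat.mul_lt_mul_of_pos_left h1 (Nat.succ_pos p)
  have h3 : (p + 1) * ((2 * p + 1).choose p * 9) = (2 * p).choose p * (9 * (2 * p + 1)) := by
    rw [← mul_assoc, succ_mul_choose_two_mul_succ]; ring
  rw [h3, show (p + 1) * ((2 * p).choose p * (R - 1)) = (2 * p).choose p * ((p + 1) * (R - 1)) by ring]
    at h2
  have h4 : (p + 1) * (R - 1) < 9 * (2 * p + 1) := Nat.lt_of_mul_lt_mul_left h2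
  by_contra hR'
  have h17 : 17 ≤ R - 1 := by omega
  have : (p + 1) * 17 ≤ (p + 1) * (R - 1) := Nat.mul_le_mul_left _ h17
  omega

/-- The catalogued barrier for the whole technique class (determinantal / linear rank methods,
`Literature.Barriers.MatrixMultiplication.LinearRankMethodBarrier`: Buczyński's cactus barrier and
EGOW 2018, PROVED in the tree as `LinearRankMethodBarrier_holds`) does NOT bite at the venture's
target: for every linear rank method `L` with `rk ≤ k` on rank-one tensors,
`rk L(⟨3,3,3⟩) ≤ k·(6·3² − 4) = 50k`, a certified quotient of at most `50 ≥ 18`. Recorded as the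
reading of the catalogue entry at `n = 3`. [cite: LandsbergGCT2017, §10.2 (p. 289)] -/
theorem linearRankMethod_ceiling_three {p q : ℕ}
    (L : ((Fin 3 × Fin 3) → (Fin 3 × Fin 3) → (Fin 3 × Fin 3) → ℂ) →ₗ[ℂ] Matrix (Fin p) (Fin q) ℂ)
    {k : ℕ} (hk : ∀ w u v : Fin 3 × Fin 3 → ℂ, (L (triad w u v)).rank ≤ k) :
    (L (matMulTensor ℂ 3 3 3)).rank ≤ k * 50 := by
  have h := Literature.Barriers.MatrixMultiplication.LinearRankMethodBarrier_holds.matMul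
    (n := 3) (by norm_num) L hk
  norm_num at h
  exact h

/-- **The border-rank window over EVERY field** (in particular `𝔽₂`): `16 ≤ R̲_K(⟨3,3,3⟩) ≤ 20`
(Landsberg–Michałek 2018 Thm. 1.1 at `(n,m,w) = (3,1,3)` = Landsberg 2017 Thm. 5.4.5.1, proved in
the tree over every field as `LandsbergMichalek_sixteen_le_algBorderRank_matMulTensor_three`, which
supersedes the conditional reading `sixteen_le_algBorderRank_three_of_LM` above; Smirnov 2013 for
`≤ 20`). In characteristic `0` the lower end is `17` (`window_algBorderRank_three`).
[cite: LandsbergMichalek2018, Thm. 1.1] -/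
theorem window_algBorderRank_three_allFields (K : Type) [Field K] :
    16 ≤ algBorderRank (matMulTensor K 3 3 3) ∧ algBorderRank (matMulTensor K 3 3 3) ≤ 20 :=
  ⟨LandsbergMichalek_sixteen_le_algBorderRank_matMulTensor_three K,
    Smirnov2013_algBorderRank_matMulTensor_three_le K⟩

/-! ## After Wang 2026: the `𝔽₂` side re-based at `20` -/

/-- **`RankGe20F2` holds by Wang 2026, Thm. 1** (`R_{𝔽₂}(⟨3,3,3⟩) ≥ 20`, verifier-checked
certificate), through the tree's named fact `Wang2026_thm1` — so the venture's `𝔽₂` lower-bound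
target as first typed is a REPRODUCTION target (an independent UNSAT certificate for `B(3,19)`
over `𝔽₂` would re-prove a printed theorem by a different method); the new number to beat over
`𝔽₂` is `21` (`RankGe21F2`). [cite: Wang2026, Thm. 1] -/
theorem rankGe20F2_of_wang (h : Wang2026_thm1) : RankGe20F2 :=
  h.matMul333

/-- **Target (rank, over `𝔽₂`, after Wang 2026)**: `21 ≤ R_{𝔽₂}(⟨3,3,3⟩)`, i.e. NO bilinear scheme
with `20` products over `𝔽₂` (the Brent system `B(3,20)` is unsatisfiable over `𝔽₂`,
`rankGe21F2_iff_brent_unsat`). OPEN (Wang 2026, §8: "the exact rank of `⟨3,3,3⟩` over `𝔽₂` is still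
open in `[20, 23]`"); a statement, not a theorem. -/
def RankGe21F2 : Prop :=
  21 ≤ tensorRank (matMulTensor (ZMod 2) 3 3 3)

/-- `RankGe21F2` refines `RankGe20F2`. -/
theorem RankGe21F2.rankGe20F2 (h : RankGe21F2) : RankGe20F2 := by
  unfold RankGe21F2 at h
  unfold RankGe20F2
  omega

/-- **`RankGe21F2` is the unsatisfiability of the Brent system `B(3,20)` over `𝔽₂`** (`729` cubic
equations in `3·20·9 = 540` unknowns). [cite: HeuleKauersSeidl2021, §2 (the Brent equations)] -/
theorem rankGe21F2_iff_brent_unsat :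
    RankGe21F2 ↔ ¬ ∃ x : Fin 3 × Fin 20 × (Fin 3 × Fin 3) → ZMod 2,
      ∀ i j k, eval x (brentSystem (ZMod 2) 3 20 i j k) = 0 := by
  rw [← tensorRank_le_iff_exists_brent_zero]
  unfold RankGe21F2
  omega

/-- **The two venture outcomes over `𝔽₂` are compatible and jointly sharp up to one unit**: given
Wang's theorem, a rank-22 `𝔽₂` scheme (`Rank22SchemeF2`, `SchemeCertificate.lean`) would leave
`R_{𝔽₂}(⟨3,3,3⟩) ∈ {20, 21, 22}`, and together with `RankGe21F2` pin it to `{21, 22}`.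
[cite: Wang2026, Thm. 1 and §8] -/
theorem tensorRank_three_F2_mem_of_wang_of_rank22 (h : Wang2026_thm1) (h22 : Rank22SchemeF2) :
    tensorRank (matMulTensor (ZMod 2) 3 3 3) ∈ Finset.Icc 20 22 := by
  have h20 := h.matMul333
  unfold Rank22SchemeF2 at h22
  simp only [Finset.mem_Icc]
  exact ⟨h20, h22⟩

/-- The exact-value form of the venture's best case over `𝔽₂`: a rank-21 refutation and a rank-22
scheme together would give `R_{𝔽₂}(⟨3,3,3⟩) = 21 ∨ = 22`; a rank-21 SCHEME instead would settle
`R_{𝔽₂}(⟨3,3,3⟩) = 21` outright given `RankGe21F2`. Stated for the latter.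
[cite: Wang2026, §8 (open in [20, 23])] -/
theorem tensorRank_three_F2_eq_of_rankGe21F2 (h21 : RankGe21F2)
    (hle : tensorRank (matMulTensor (ZMod 2) 3 3 3) ≤ 21) :
    tensorRank (matMulTensor (ZMod 2) 3 3 3) = 21 := by
  unfold RankGe21F2 at h21
  omega

end Summit.Ventures.MM22

end
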